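import Literature.Analysis.FluidPDE.NSBoundedMildSmoothing
import Literature.Analysis.FluidPDE.NSBoundedMildOseenRestart
import Literature.Analysis.FluidPDE.KNSSLocalSmoothingHolds
import Literature.Analysis.FluidPDE.NSBoundedMildOseenClassical
import Literature.Analysis.FluidPDE.NSBoundedMildOseenIntegral
import Literature.Analysis.FluidPDE.NSCriticalClosureBesovBounded
import HarnessLib

/-!
# KNSS 2009, Prop. 4.1 (smoothing of bounded mild solutions) and its use for bounded Besov mild
# solutions — discharged

Analysis/FluidPDE glue file **discharging two named facts**:

* `Literature.Analysis.FluidPDE.knss2009_smoothing` (`NSBoundedMildOseen.lean`; G. Koch,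
  N. Nadirashvili, G. Seregin, V. Šverák, *Liouville theorems for the Navier–Stokes equations and
  applications*, Acta Math. 203 (2009) = arXiv:0709.3599, Prop. 4.1, p. 8: for a bounded mild
  solution "the functions `t^{k/2+l} ∇ᵏₓ ∂ₜˡ u` are bounded"), by the accepted reduction
  `knss2009_smoothing_of_local` (`NSBoundedMildSmoothing.lean`: the global statement from the
  restart property (R) and the quantitative short-time form (L)) and the accepted discharges
  `oseenMild_restart_holds` (`NSBoundedMildOseenRestart.lean`) and
  `knss2009_local_smoothing_holds` (`KNSSLocalSmoothingHolds.lean`);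
* `Literature.Analysis.FluidPDE.knss_classical_of_bounded_isBesovMildSolutionOn`
  (`NSCriticalClosureBesovBounded.lean`; KNSS 2009, §4 with Lemma 3.1, Rem. 3.1, Prop. 4.1:
  bounded Besov mild solutions are classical at positive times), by the accepted reduction
  `knss_classical_of_bounded_isBesovMildSolutionOn_of_oseen` (`NSBoundedMildOseen.lean`) fed with
  `oseenMild_of_bounded_isBesovMildSolutionOn_holds` (`NSBoundedMildOseenIntegral.lean`),
  `oseenMild_restart_holds`, the first discharge, and `classical_of_smooth_isMildNSSolutionOn_holds`
  (`NSBoundedMildOseenClassical.lean`).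

Theorem-only glue module: no definitions, no named facts, no `sorry`; each theorem is a
composition of an accepted tree reduction with accepted discharges (pure proofs of unchanged
statements).

## References

* G. Koch, N. Nadirashvili, G. Seregin, V. Šverák, *Liouville theorems for the Navier–Stokes
  equations and applications*, Acta Math. 203 (2009) 83–105 = arXiv:0709.3599, §4, Prop. 4.1,
  Rem. 4.1, Lemma 3.1, Rem. 3.1. [KochNadirashviliSereginSverak2009]
* P. G. Lemarié-Rieusset, *The Navier–Stokes Problem in the 21st Century*, CRC Press 2016,
  Thm. 9.12. [LemarieRieusset2016]
-/

noncomputable section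

namespace Literature.Analysis.FluidPDE

section Smoothing

variable (E : Type*) [NormedAddCommGroup E] [InnerProductSpace ℝ E] [FiniteDimensional ℝ E]
  [MeasurableSpace E] [BorelSpace E]

/-- **KNSS 2009, Prop. 4.1 (smoothing of bounded mild solutions), proved** (the named statement
`knss2009_smoothing E`), by `knss2009_smoothing_of_local`, `oseenMild_restart_holds` and
`knss2009_local_smoothing_holds`. [cite: KochNadirashviliSereginSverak2009, Prop. 4.1 (arXiv:0709.3599 p. 8)] -/
theorem knss2009_smoothing_holds : knss2009_smoothing E :=
  knss2009_smoothing_of_local (oseenMild_restart_holds E) (knss2009_local_smoothing_holds E)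

end Smoothing

/-- **Bounded Besov mild solutions are classical at positive times (KNSS 2009, §4), proved**
(the named statement `knss_classical_of_bounded_isBesovMildSolutionOn`), by
`knss_classical_of_bounded_isBesovMildSolutionOn_of_oseen` with
`oseenMild_of_bounded_isBesovMildSolutionOn_holds`, `oseenMild_restart_holds`,
`knss2009_smoothing_holds` and `classical_of_smooth_isMildNSSolutionOn_holds`. [cite: KochNadirashviliSereginSverak2009, §4 with Lemma 3.1, Rem. 3.1, Prop. 4.1] -/
theorem knss_classical_of_bounded_isBesovMildSolutionOn_holds :
    knss_classical_of_bounded_isBesovMildSolutionOn :=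
  knss_classical_of_bounded_isBesovMildSolutionOn_of_oseen
    oseenMild_of_bounded_isBesovMildSolutionOn_holds
    (oseenMild_restart_holds (EuclideanSpace ℝ (Fin 3)))
    (knss2009_smoothing_holds (EuclideanSpace ℝ (Fin 3)))
    (classical_of_smooth_isMildNSSolutionOn_holds (EuclideanSpace ℝ (Fin 3)))

end Literature.Analysis.FluidPDE

end
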